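import Mathlib
import Literature.Analysis.FluidPDE.IsometryInvariance
import Literature.Analysis.FluidPDE.AxisymmetricVorticityTransport
import Summits.NavierStokesRegularity.NavierStokesRegularity.Theorems.EulerZoomLiouvillePowerGaugeEulerLiouvilleAxisymSlowDrifting
import HarnessLib

/-!
# Crux E `PowerGaugeEulerLiouville` (stmt-NavierStokesRegularity-19832): PRESSURE SYMMETRY — a classical Euler pressure inherits every
# linear isometry of its velocity EXACTLY; the pressure-axisymmetry clause of `IsAxisymSlowDrifting` is automatic
# (lane «pressure slaving», classical chapter; width seat ns-ezl-w3 g3)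

Route `EulerZoomLiouville` (NavierStokesRegularity), crux E; LEAD ns-typeII-p2 g12, skeleton `Lines/birth.lean` v59.  The skeleton predicate
`IsAxisymSlowDrifting ρ u p` (v44) asks for axisymmetric velocity AND pressure slices, `IsAxisymmetric (u τ) ∧ IsAxisymmetricScalar (p τ)` — the
pressure symmetry is consumed by the swirl transport of line `swirl-capacity` (`SwirlCapacity.swirlBlobsPersist_of_axiDriftingWith`: `D_t(r u_θ) = −∂_θ p = 0`).
For a CLASSICAL Euler pair it is automatic, and this file records the class-free reason:

* `PressureSymmetry.pressure_comp_eq_of_velocity_equivariant` — **a classical Euler/Navier–Stokes pressure inherits every linear isometry of the velocity**: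
  if `(u, p)` is a classical solution on a time set `S` of unique differentiability (force `0`) and `u t (R x) = R (u t x)` for `t ∈ S` and a linear
  isometry `R : E ≃ₗᵢ[ℝ] E`, then `p t (R x) = p t x` for every `t ∈ S` and EVERY `x` — exactly, not up to a time constant.  Proof: the conjugated
  pair `(R u(t, R⁻¹·), p(t, R⁻¹·))` is again a classical solution (`IsClassicalNSSolutionOn.conj_linearIsometryEquiv`, Majda–Bertozzi Prop. 1.1 (iii)) with
  the SAME velocity on `S`; subtracting the two momentum equations gives `∇(p t ∘ R⁻¹) = ∇(p t)`, so `p t ∘ R⁻¹ − p t` is constant, and the constant is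
  `0` because `R` fixes the origin.
* `PressureSymmetry.isAxisymmetricScalar_pressure` — classical Euler on `S` with axisymmetric velocity slices ⇒ axisymmetric pressure slices (`R = R_θ`).
* MEMBER FORM for the skeleton: `AxisymSlowDrifting.ae_eq_zero_of_gauge_of_axisymSlowDrifting_velocity` = the tree's
  `AxisymSlowDrifting.ae_eq_zero_of_gauge_of_axisymSlowDrifting'` (p620289/p616335 union) with the conjunct `IsAxisymmetricScalar (p τ)` DELETED — so the LEAD may
  drop the pressure-symmetry clause of `IsAxisymSlowDrifting` by name (classical axisymmetric members with drift exponent `κ ∈ ((1−ρ)/(2−ρ), 1)`, swirl or not,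
  are trivial, with no hypothesis on the pressure beyond classicality).

WHAT THIS IS NOT: not NS regularity, not the crux E — a structural lemma on the crux CLASS 19832 (MODEL lattice; E/NS strata) `--supports` stmt-19832; the weak-class
(a.e.) version via pressure uniqueness is the sequel `…PressureSlavingIsometry`.  [folklore; MajdaBertozziCUP2002 §1.2 Prop. 1.1 (iii); KNSS2009 §1]
-/

noncomputable section

-- flat `Theorems/<Route><Decl>…` files of one crux share the namespace of the crux (tree convention: `Summit.<S>.<S>.…`)
set_option linter.dupNamespace false

open MeasureTheory Set Filter Topology Metric Function
open scoped NNReal InnerProductSpace Laplacian ContDiff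

namespace Summit.NavierStokesRegularity.NavierStokesRegularity.Theorems.PowerGaugeEulerLiouville

open Literature.Analysis Literature.Analysis.FluidPDE

namespace PressureSymmetry

variable {E : Type*} [NormedAddCommGroup E] [InnerProductSpace ℝ E] [FiniteDimensional ℝ E]

/-! ### Classical solutions: exact inheritance -/

/-- **A CLASSICAL EULER / NAVIER–STOKES PRESSURE INHERITS EVERY LINEAR ISOMETRY OF ITS VELOCITY.**  `(u, p)` a classical solution (any viscosity `ν`,
force `0`) on a time set `S` of unique differentiability, `R` a linear isometry with `u t (R x) = R (u t x)` for `t ∈ S`; then `p t (R x) = p t x` for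
all `t ∈ S`, `x`.  (Conjugate solution with the same velocity ⇒ equal pressure gradients ⇒ the difference is a constant, which vanishes at the fixed
point `0` of `R`.) [cite: MajdaBertozziCUP2002, §1.2 Prop. 1.1 (iii)] -/
theorem pressure_comp_eq_of_velocity_equivariant {S : Set ℝ} {ν : ℝ} {u : ℝ → E → E} {p : ℝ → E → ℝ}
    (h : IsClassicalNSSolutionOn S ν 0 u p) (hS : UniqueDiffOn ℝ S) (R : E ≃ₗᵢ[ℝ] E)
    (hequiv : ∀ t ∈ S, ∀ x : E, u t (R x) = R (u t x)) {t : ℝ} (ht : t ∈ S) (x : E) :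
    p t (R x) = p t x := by
  -- the conjugated solution and its velocity on `S`
  have h' := h.conj_linearIsometryEquiv R hS
  have hvel : ∀ s ∈ S, (fun y : E => R (u s (R.symm y))) = u s := by
    intro s hs
    funext y
    rw [← hequiv s hs (R.symm y), LinearIsometryEquiv.apply_symm_apply]
  -- equal pressure gradients at time `t`
  have hgrad : ∀ y : E, gradient (p t) y = gradient (fun z : E => p t (R.symm z)) y := by
    intro y
    have hm := h.momentum t ht y
    have hm' := h'.momentum t ht y
    have htd : timeDerivWithin S (fun s (z : E) => R (u s (R.symm z))) t y = timeDerivWithin S u t y := by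
      simp only [timeDerivWithin]
      exact derivWithin_congr (fun s hs => congrFun (hvel s hs) y) (congrFun (hvel t ht) y)
    have hcv : convect (fun z : E => R (u t (R.symm z))) (fun z : E => R (u t (R.symm z))) y = convect (u t) (u t) y := by
      rw [hvel t ht]
    have hlap : (Δ (fun z : E => R (u t (R.symm z)))) y = (Δ (u t)) y := by
      rw [hvel t ht]
    simp only [Pi.zero_apply, map_zero, add_zero] at hm hm'
    rw [htd, hcv, hlap, hm] at hm'
    -- `ν • Δu − ∇p = ν • Δu − ∇p'`
    have := sub_right_injective hm'
    exact this
  -- hence equal Fréchet derivatives, so the difference is constant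
  have hpt : Differentiable ℝ (p t) := (h.contDiff_pressure ht).differentiable (by simp)
  have hp't : Differentiable ℝ (fun z : E => p t (R.symm z)) := (h'.contDiff_pressure ht).differentiable (by simp)
  have hfd : ∀ y : E, fderiv ℝ (fun z : E => p t (R.symm z) - p t z) y = 0 := by
    intro y
    have hg := hgrad y
    simp only [gradient] at hg
    have hg' : fderiv ℝ (p t) y = fderiv ℝ (fun z : E => p t (R.symm z)) y :=
      (InnerProductSpace.toDual ℝ E).symm.injective hg
    rw [fderiv_fun_sub (hp't y) (hpt y), ← hg', sub_self]
  have hdiff : Differentiable ℝ (fun z : E => p t (R.symm z) - p t z) := hp't.sub hpt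
  have hconst := is_const_of_fderiv_eq_zero hdiff hfd (R x) 0
  simp only [LinearIsometryEquiv.symm_apply_apply, map_zero, sub_self] at hconst
  linarith

/-- The same with the isometry on the other side: `p t (R⁻¹ x) = p t x`. [cite: MajdaBertozziCUP2002, §1.2 Prop. 1.1 (iii)] -/
theorem pressure_comp_symm_eq_of_velocity_equivariant {S : Set ℝ} {ν : ℝ} {u : ℝ → E → E} {p : ℝ → E → ℝ}
    (h : IsClassicalNSSolutionOn S ν 0 u p) (hS : UniqueDiffOn ℝ S) (R : E ≃ₗᵢ[ℝ] E)
    (hequiv : ∀ t ∈ S, ∀ x : E, u t (R x) = R (u t x)) {t : ℝ} (ht : t ∈ S) (x : E) :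
    p t (R.symm x) = p t x := by
  have h1 := pressure_comp_eq_of_velocity_equivariant h hS R hequiv ht (R.symm x)
  rw [LinearIsometryEquiv.apply_symm_apply] at h1
  exact h1.symm

/-! ### Axisymmetry of the pressure -/

/-- **CLASSICAL EULER WITH AXISYMMETRIC VELOCITY HAS AXISYMMETRIC PRESSURE** (no hypothesis on `p` beyond classicality): `(u, p)` classical on `S`
(unique differentiability, force `0`, any `ν`) with `IsAxisymmetric (u t)` for `t ∈ S` ⇒ `IsAxisymmetricScalar (p t)` for `t ∈ S` (the rotations
`R_θ` about the axis are linear isometries fixing the origin). [cite: KNSS2009, §1] -/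
theorem isAxisymmetricScalar_pressure {S : Set ℝ} {ν : ℝ}
    {u : ℝ → EuclideanSpace ℝ (Fin 3) → EuclideanSpace ℝ (Fin 3)} {p : ℝ → EuclideanSpace ℝ (Fin 3) → ℝ}
    (h : IsClassicalNSSolutionOn S ν 0 u p) (hS : UniqueDiffOn ℝ S)
    (hax : ∀ t ∈ S, IsAxisymmetric (u t)) {t : ℝ} (ht : t ∈ S) : IsAxisymmetricScalar (p t) := by
  intro θ x
  have hequiv : ∀ s ∈ S, ∀ y : EuclideanSpace ℝ (Fin 3), u s (rotZLIE θ y) = rotZLIE θ (u s y) :=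
    fun s hs y => by simpa only [rotZLIE_apply] using hax s hs θ y
  simpa only [rotZLIE_apply] using pressure_comp_eq_of_velocity_equivariant h hS (rotZLIE θ) hequiv ht x

/-- Slab form on `(−∞, 0)`: classical Euler with axisymmetric velocity slices ⇒ axisymmetric velocity AND pressure slices — the symmetry conjunct of
`IsAxisymSlowDrifting` from its velocity half. [cite: KNSS2009, §1] -/
theorem axisym_pair_of_velocity
    {u : ℝ → EuclideanSpace ℝ (Fin 3) → EuclideanSpace ℝ (Fin 3)} {p : ℝ → EuclideanSpace ℝ (Fin 3) → ℝ}
    (hcl : IsClassicalEulerSolutionOn (Iio 0) 0 u p) (hax : ∀ τ : ℝ, τ < 0 → IsAxisymmetric (u τ)) :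
    ∀ τ : ℝ, τ < 0 → IsAxisymmetric (u τ) ∧ IsAxisymmetricScalar (p τ) :=
  fun τ hτ => ⟨hax τ hτ, isAxisymmetricScalar_pressure hcl (uniqueDiffOn_Iio 0) (fun t ht => hax t ht) hτ⟩

end PressureSymmetry

/-! ### Member form: `IsAxisymSlowDrifting` without the pressure-symmetry clause -/

namespace AxisymSlowDrifting

variable {u : ℝ → EuclideanSpace ℝ (Fin 3) → EuclideanSpace ℝ (Fin 3)} {p : ℝ → EuclideanSpace ℝ (Fin 3) → ℝ}
  {H : ℝ → EuclideanSpace ℝ (Fin 3) → EuclideanSpace ℝ (Fin 3) →L[ℝ] EuclideanSpace ℝ (Fin 3)} {c : ℝ≥0}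

/-- **CLASSICAL AXISYMMETRIC MEMBERS WITH DRIFT EXPONENT `κ ∈ ((1−ρ)/(2−ρ), 1)` ARE TRIVIAL — VELOCITY-ONLY SYMMETRY CLAUSE.**  Crux hypotheses verbatim
(`0 < ρ ≤ ½`, suitable weak Euler on the past slab, weak gradient `H`, power gauges `≤ c`) + classical Euler on `(−∞,0)` with AXISYMMETRIC VELOCITY slices
(nothing asked of the pressure) + `∃ M κ, 0 ≤ M ∧ (1−ρ)/(2−ρ) < κ ∧ κ < 1 ∧ ‖u(τ,x)‖ ≤ M(−τ)^{−κ}` ⇒ `u = 0` a.e. on `(−∞,0) × ℝ³`.  = the tree's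
`ae_eq_zero_of_gauge_of_axisymSlowDrifting'` after `PressureSymmetry.axisym_pair_of_velocity`; the shape of the skeleton predicate `IsAxisymSlowDrifting ρ u p` with
its conjunct `IsAxisymmetricScalar (p τ)` deleted. [folklore] -/
theorem ae_eq_zero_of_gauge_of_axisymSlowDrifting_velocity {ρ : ℝ} (hρ : 0 < ρ) (hρh : ρ ≤ 1 / 2)
    (hsw : IsSuitableWeakSolutionOn (slab (EuclideanSpace ℝ (Fin 3)) (Iio 0) isOpen_Iio) 0 0 u p)
    (hH : HasWeakSpatialGradientOn (slab (EuclideanSpace ℝ (Fin 3)) (Iio 0) isOpen_Iio) u H)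
    (hgauge : ∀ a : ℝ, 0 < a →
      ENNReal.ofReal (a ^ (2 * ρ)) * cknA a (0 : ℝ × EuclideanSpace ℝ (Fin 3)) u +
          ENNReal.ofReal (a ^ ρ) * cknE a (0 : ℝ × EuclideanSpace ℝ (Fin 3)) H +
        ENNReal.ofReal (a ^ (2 * ρ)) * cknD a (0 : ℝ × EuclideanSpace ℝ (Fin 3)) p ≤ (c : ENNReal))
    (hstr : IsClassicalEulerSolutionOn (Iio 0) 0 u p ∧
      (∀ τ : ℝ, τ < 0 → IsAxisymmetric (u τ)) ∧
      ∃ M κ : ℝ, 0 ≤ M ∧ (1 - ρ) / (2 - ρ) < κ ∧ κ < 1 ∧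
        ∀ τ : ℝ, τ < 0 → ∀ x : EuclideanSpace ℝ (Fin 3), ‖u τ x‖ ≤ M * (-τ) ^ (-κ)) :
    uncurry u =ᵐ[volume.restrict (Iio (0 : ℝ) ×ˢ (univ : Set (EuclideanSpace ℝ (Fin 3))))] 0 := by
  obtain ⟨hcl, hax, hMκ⟩ := hstr
  exact ae_eq_zero_of_gauge_of_axisymSlowDrifting' hρ hρh hsw hH hgauge ⟨hcl, PressureSymmetry.axisym_pair_of_velocity hcl hax, hMκ⟩

end AxisymSlowDrifting

end Summit.NavierStokesRegularity.NavierStokesRegularity.Theorems.PowerGaugeEulerLiouville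

end
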